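import Summits.BirchSwinnertonDyer.Rank1Residual.X11b.BDPRouteOddPrimeClass
import Literature.NumberTheory.EllipticCurves.Rank1Residual.X10bMatarNekovarIndexBound
import HarnessLib

/-!
# X11b, the JETCHEV road on the Tamagawa atom (T2′), file 1/2: the labelled binder "Jetchev's
# Tamagawa-sharpened index bound over `K`, READ at `p ∣ N`" and the data-level arithmetic of the
# sharpened upper half (cell `b2b-bsdres`, team `x11b3` = N8/O2, seat p5, PLAN v1 §2 S5 · JET3N (c))

HONEST FRAMING (cell `b2b-bsdres`, run/shared/lean/b2b/bsd-rank1-residual/, verbatim in every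
file): the goal of the cell is to DELETE the COMBINATION-SHAPED residual classes of the
Birch–Swinnerton-Dyer formula for ALL analytic-rank `≤ 1` elliptic curves over `ℚ` — "full BSD
formula for every rank `≤ 1` curve in class `C`" assembled STRICTLY from published theorems — so
that the rank-`≤ 1` remainder becomes exactly the CONSTRUCTION-SHAPED classes, which are TYPED
(missing-input `Prop`s), NOT attempted. This is not "finishing BSD". Team `x11b3` is a RESEARCH
team; no claim beyond the stated class and sub-atom; X11b and X11 ∧ `r = 1` ∧ `p = 3` stay
CONSTRUCTION-SHAPED (REFEREE R6.2); §I O2 stays OPEN; nothing here is booked; census numbers quoted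
below are EVIDENCE pointers, never inputs. THEOREMS ONLY (no definition, no named fact, no `sorry`); the Jetchev-shape input
enters file 2/2 as an explicit LABELLED hypothesis, written out in §1 below.

## What this file does

On class X11b (`r_an = 1 ∧ p ≠ 2 ∧ mult(p) ∧ irr(p)`) with a (ram) prime, route p2's kernel
(multr1-p2, `X11b/BDPRouteHalves*.lean`, `BDPRouteOddPrime*.lean`) gives the Euler-system half
`ord_p #Ш(E) ≤ ord_p #Ш(E)_an` UNCONDITIONALLY on atom A1 (`p ∤ ∏_ℓ c_ℓ(E)`) from Kolyvagin's bound
`ord_p #Ш(E/K) ≤ 2·ord_p [E(K):ℤP]` over the Hoffstein–Luo Heegner field, Gross–Zagier bookkeeping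
and Skinner 2016 Thm. C for the twist; on the Tamagawa atom (T2′) = (ram) ∧ `p ∣ ∏c_ℓ` only the
DEFECT form `ord_p #Ш(E) ≤ ord_p #Ш(E)_an + 2·ord_p ∏_ℓ c_ℓ(E)`, because Kolyvagin's bound is blind
to the Tamagawa term `Σ_{w ∣ N} ord_p c_w(E/K) = 2·ord_p ∏_ℓ c_ℓ(E)` of BSD over a field in which
every `ℓ ∣ N` splits. Jetchev, Compos. Math. **144** (2008) Thm. 1.1 (= arXiv math/0703431
Thm. 1.4 + Cor. 1.5) recovers `2·max_{q ∣ N} ord_p c_q(E)` of it: "Assume that the Heegner point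
`y_K` has infinite order in `E(K)` and that `p` satisfies Hypothesis (∗). If
`m_max = max_{q∣N} ord_p(c_q)`, then `m_∞ ⩾ m_max`. As a consequence … `#Ш(E/K)[p^∞] ⩽ p^{2m₀−2m_max}`
… If `p` divides at most one Tamagawa number, our upper bound coincides with the exact upper bound
predicted by the Birch and Swinnerton-Dyer conjectural formula for `E/K`", under "Hypothesis (∗).
We have `p ∤ 2N` and … `ρ_{E,p}` … is surjective" [corpus: `paper:url-a6dac776b4aa` p0002 L2–L4,
L26–L31 = printed p. 812; harvest-2 GEN 29/30 E66 (A)] — i.e. NOT at the pairs of X11b (`p ∥ N`).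

§1 records the SHAPE of the binder (a comment, no definition): the tree's PUBLISHED Kolyvagin-shape
fact `Kolyvagin1990_padicValNat_card_sha_le N W K` (McCallum 1991 §1; binders COPIED) with Jetchev's
Tamagawa term `2·ord_p c_q(E)` added for every prime `q ∣ N`, RESTRICTED to `p ∣ N` — exactly the
part of Thm. 1.1 that is OFF print; every consumer (file 2/2) takes it as an explicit hypothesis
`hJ`, labelled `[claim: Jetchev2008, status: under-review]` = the lane's reading flag `JET@p|N`
(bsdN/HYPOTHESES.md v2, referee A G28). Anatomy of record (harvest-2 GEN 29 E66 (C), not re-derived here): the one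
printed step meeting `p` versus `N` is Prop. 4.1's use of Lemma 4.3 ("Let `v ∤ p` … `E⁰(K_v^ur)` is
`p`-divisible") at a place `v ∣ p ∣ N`; its algebraic replacement (Gross 1991 Prop. 6.2 (1) carried
one step inside the component group) is the tree's kernel theorem
`X11b/JetchevConnectedKummerCore.lean` (p248445); §3, Lemma 3.2 ("`p` odd"), Thm. 3.3, §§5–7 and
Kolyvagin's structure theorem have no `p`-versus-`N` step. A kernel DISCHARGE of the hypothesis would
need those ≈ 8 printed pages plus the structure theorem as a cited fact without `p ∤ N` (E66 (D),
size L/XL) — NOT attempted; nothing here moves a tier (referee A's call).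
§1 also proves: over-`K` ⇒ over-`ℚ` (`padicValNat_shaOrder_add_le_of_baseChange`): the over-`K`
shape implies the OVER-`ℚ` shape `ord_p #Ш(E/ℚ) + 2·ord_p c_q ≤ 2·ord_p [E(K):ℤP]` (the hypothesis
`hJ` of this seat's per-pair consumer `Three.bsdp_of_jetchevShapeAt_of_card_selmer` in
`Three/TamagawaAtomSelmerCertificate.lean` §3, = the shape of Miller 2011 Thm. 5.4) — the two
currencies agree.

§2 is pure arithmetic on top of multr1-p2's `exists_shaAn_padicVal_eq_of_heegner`: from a SHARPENED
bound `ord_p #Ш(E/K) + 2w ≤ 2·ord_p [E(K):ℤP]` (supplied by whoever, at whatever tier),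
`missingUpperBoundAt_of_shaIndexBound_sharp` (the upper half when `ord_p ∏c_ℓ(E) ≤ w`),
`padicValNat_shaOrder_le_add_sub_of_shaIndexBound_sharp` (the residual defect
`2·(ord_p ∏c_ℓ − w)` in general), and `sharp_of_heegnerData_of_odd` (both, after the odd-`d_K`
transports to the minimal twist model and Skinner's Thm. C — multr1-p2's
`halves_of_heegnerData_of_odd` pattern). File 2/2 (`Three/JetchevMonoCarrier.lean`) is the class
level: on the MONO-CARRIER sub-atom of (T2′) (`ord_p ∏c_ℓ(E) ≤ ord_p c_q(E)` for ONE `q`) the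
reading is the whole missing upper half, every odd `p` and at `p = 3`.

References: [Jetchev2008] Thm. 1.1 and Hypothesis (∗) (Compos. Math. 144 (2008) p. 812), Prop.
4.1, Lemmas 4.2–4.3 (p. 820), Rem. 6.2; [JetchevSkinnerWan2017] §7.4.1–7.4.2 (pp. 30–31);
[McCallumLMS1991] §1 Theorem (Kolyvagin), p. 296; [GrossLMS1991] Prop. 6.2 (1) (pp. 244–245);
[Skinner2016PacificMC] Thm. C and footnote 1; [Miller2011LMS] Def. 1.1, Thm. 5.4;
[SerreGaloisCohomology1997] I.§2.4; cell files `X11b/BDPRouteHalves.lean`, `BDPRouteOddPrime.lean`,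
`BDPRouteTamagawaDefect.lean`, `JetchevConnectedKummerCore.lean`; harvest-2 HARVEST.md §GEN-29/30 E66.
-/

noncomputable section

open scoped Classical

open WeierstrassCurve NumberField Literature.NumberTheory.EllipticCurves
  Literature.NumberTheory.EllipticCurves.ModularForms
  Literature.NumberTheory.EllipticCurves.Rank1Residual
  Literature.NumberTheory.EllipticCurves.KrizLi2019

namespace Summit.BirchSwinnertonDyer.Rank1Residual.X11b

/-! ### §1. The hypothesis SHAPE (no definition): Jetchev's bound over `K`, read at `p ∣ N` -/

/-
THE BINDER, as every consumer of file 2/2 spells it out (an explicit hypothesis, NOT a definition and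
NOT a Literature fact; at `p ∣ N` it is the lane's READING `JET@p|N` [claim: Jetchev2008, status:
under-review]; its binders are those of the tree's PUBLISHED Kolyvagin-shape fact
`Kolyvagin1990_padicValNat_card_sha_le N W K` plus `p ∣ N` and the prime `q ∣ N`):

  ∀ (N : ℕ) [NeZero N] (W : WeierstrassCurve ℚ) [W.IsElliptic] (K : Type) [Field K] [NumberField K],
    IsImaginaryQuadratic K → SatisfiesHeegnerHypothesis N K →
    ∀ {P : (W.baseChange K).toAffine.Point}, IsHeegnerPoint N W K P → ¬ IsOfFinAddOrder P →
    p ∣ N → W.HasSurjectiveModNGaloisRep p → ∀ (q : ℕ) [Fact q.Prime], q ∣ N →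
      padicValNat p (Nat.card (W.baseChange K).sha) +
          2 * padicValNat p ((W.baseChange ℚ_[q]).localTamagawaNumber ℤ_[q]) ≤
        2 * padicValNat p (AddSubgroup.zmultiples P).index
-/

/-- **Over `K` ⇒ over `ℚ`** (bookkeeping for the two currencies of this seat). For `W/ℚ`, an
imaginary quadratic `K`, an odd prime `p` and finite `Ш(E/K)`: any inequality
`ord_p #Ш(E/K) + c ≤ b` implies `ord_p #Ш(E/ℚ) + c ≤ b`, because `ord_p #Ш(E/ℚ) ≤ ord_p #Ш(E/K)`
(restriction is injective on the `p`-primary part for `p ∤ [K:ℚ] = 2`; tree theorem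
`padicValNat_shaOrder_le_baseChange_of_odd`, and `Ш(E/ℚ)` is finite with `Ш(E/K)`,
`shaFinite_of_baseChange`). With `c = 2·ord_p c_q(E)`, `b = 2·ord_p [E(K):ℤP]` this turns the
OVER-`K` Jetchev shape of §1 into the OVER-`ℚ` shape `hJ` consumed per pair by
`X11b.Three.bsdp_of_jetchevShapeAt_of_card_selmer` (`Three/TamagawaAtomSelmerCertificate.lean` §3) —
the shape of Miller 2011 Thm. 5.4: whoever supplies the over-`K` reading supplies the over-`ℚ` one.
[cite: SerreGaloisCohomology1997, I.§2.4 Cor. to Prop. 9] [cite: Miller2011LMS, Thm. 5.4 (shape) and Def. 1.1] -/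
theorem padicValNat_shaOrder_add_le_of_baseChange (W : WeierstrassCurve ℚ) [W.IsElliptic]
    (K : Type) [Field K] [NumberField K] (hK : IsImaginaryQuadratic K) (p : ℕ) [Fact p.Prime]
    (hp2 : p ≠ 2) (hfinK : Finite (W.baseChange K).sha) {c b : ℕ}
    (h : padicValNat p (Nat.card (W.baseChange K).sha) + c ≤ b) :
    padicValNat p W.shaOrder + c ≤ b := by
  have h2 := padicValNat_shaOrder_le_baseChange_of_odd W K hK p hp2
    (shaFinite_of_baseChange W K hfinK) hfinK
  omega

/-! ### §2. Data level: the upper half from a SHARPENED index bound over `K` (pure arithmetic) -/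

/-- **The Euler-system half from a Tamagawa-SHARPENED bound of Kolyvagin's shape over `K`.** Same
data and PUBLISHED binders as multr1-p2's `missingUpperBoundAt_of_shaIndexBound`
(`X11b/BDPRouteHalves.lean`: `W/ℚ` globally minimal, `ord_{s=1} L(E,s) = 1`; `K` imaginary quadratic
with the Heegner hypothesis for `N` and `L(E^{d_K},1) ≠ 0`; `P` the Heegner point of a datum with
`p ∤ c`; `p` odd, `p ∤ #𝓞_K^×`; `Wd = Cd • W^{(d_K)}` globally minimal with `ord_p u(Cd) = 0` and
`ord_p ∏c_ℓ(Wd) = ord_p ∏c_ℓ(W)`; `htw` the `≥`-half of the rank-`0` `p`-part for the twist; `hGZ`,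
`hKo`, `hGZK`, `hmod`), with Kolyvagin's hypothesis pair (`p ∤ ∏c_ℓ(E)`, `ord_p #Ш(E/K) ≤ 2·ord_p I`)
replaced by a SHARPENED pair: a weight `w` with `ord_p ∏_ℓ c_ℓ(E) ≤ w` (`htamw`) and
`ord_p #Ш(E/K) + 2w ≤ 2·ord_p [E(K):ℤP]` (`hU`). CONCLUSION: `Typed.MissingUpperBoundAt W p`.
Arithmetic: `v(Ш_W) + v(Ш_d) = v(Ш_K) ≤ 2v(I) − 2w = v(q) + v(q_d) + v(c_W) + 2v(t_d) − 2w
≤ v(q) + v(Ш_d) + v(c_d) + v(c_W) − 2w = v(q) + v(Ш_d) + 2(v(c_W) − w) ≤ v(q) + v(Ш_d)`.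
With `w = 0` this is multr1-p2's theorem; with `w = ord_p c_q(E) ≥ ord_p ∏c_ℓ(E)` (mono-carrier) and
`hU` = the Jetchev shape it is §3. NO typed input; who supplies `hU` decides its tier.
[cite: JetchevSkinnerWan2017, §7.4.2 (eq:shaupper), p. 31] [cite: Jetchev2008, Thm. 1.1 (shape)]
[cite: Miller2011LMS, Def. 1.1] -/
theorem missingUpperBoundAt_of_shaIndexBound_sharp
    (W : WeierstrassCurve ℚ) [W.IsElliptic] [W.IsGloballyMinimal] (p : ℕ) [Fact p.Prime]
    (N : ℕ) [NeZero N] (K : Type) [Field K] [NumberField K]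
    (Dt : ModularParametrizationData W N) (H : HeegnerDatum N (NumberField.discr K)) (ι : K →+* ℂ)
    (P : (W.baseChange K).toAffine.Point)
    -- the published inputs (named facts of the tree)
    (hGZ : gross_zagier N W K) (hKo : kolyvagin N W K)
    (hGZK : rank_eq_analyticRank_of_analyticRank_le_one) (hmod : hasEntireLFunction_rat)
    -- the data
    (hK : IsImaginaryQuadratic K) (hHN : SatisfiesHeegnerHypothesis N K)
    (hP : WeierstrassCurve.Affine.Point.map ι.toRatAlgHom P = heegnerPointComplex Dt H)
    (hp2 : p ≠ 2) (hc : ¬ (p : ℤ) ∣ Dt.c) (hμ : ¬ p ∣ Units.torsionOrder K)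
    (hr : W.analyticRank = 1)
    (hLt : (W.quadraticTwist (NumberField.discr K : ℚ)).entireLFunction 1 ≠ 0)
    -- a globally minimal model of the quadratic twist by `d_K`
    (Wd : WeierstrassCurve ℚ) [Wd.IsElliptic] [Wd.IsGloballyMinimal] (Cd : VariableChange ℚ)
    (hWd : Cd • W.quadraticTwist (NumberField.discr K : ℚ) = Wd)
    (hu : padicValRat p (Cd.u : ℚ) = 0)
    (htam : padicValNat p Wd.tamagawaProduct = padicValNat p W.tamagawaProduct)
    -- the weight: all of `ord_p ∏c_ℓ(E)` is absorbed
    {w : ℕ} (htamw : padicValNat p W.tamagawaProduct ≤ w)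
    -- the `≥`-half of the rank-zero `p`-part for the twist
    (htw : ∃ q : ℚ, Wd.entireLFunction 1 / (Wd.realPeriodRat : ℂ) = (q : ℂ) ∧
      padicValRat p q ≤ (padicValNat p Wd.shaOrder : ℤ) + padicValNat p Wd.tamagawaProduct -
        2 * padicValNat p Wd.torsionOrder)
    -- a SHARPENED upper bound of Kolyvagin's shape over `K`
    (hU : Finite (W.baseChange K).sha → ¬ IsOfFinAddOrder P →
      padicValNat p (Nat.card (W.baseChange K).sha) + 2 * w ≤
        2 * padicValNat p (AddSubgroup.zmultiples P).index) :
    Typed.MissingUpperBoundAt W p := by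
  obtain ⟨qd, hqd, hvqd⟩ := htw
  obtain ⟨-, hfinK, hsha, q, hq, hval⟩ := exists_shaAn_padicVal_eq_of_heegner W p N K Dt H ι P
    hGZ hKo hGZK hmod hK hHN hP hp2 hc hμ hr hLt Wd Cd hWd hu qd hqd
  -- the Heegner point has infinite order (`L'(E,1) ≠ 0`, `L(E^D,1) ≠ 0`, Gross–Zagier)
  have hL0 : W.entireLFunction 1 = 0 := entireLFunction_one_eq_zero_of_analyticRank_eq_one hr
  obtain ⟨-, hderiv⟩ := leadingLCoeff_eq_deriv_of_analyticRank_eq_one hr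
  have hLK : LDerivEK W K ≠ 0 := by
    rw [lDerivEK_eq_deriv_mul W K hmod hL0]; exact mul_ne_zero hderiv hLt
  have hPinf : ¬ IsOfFinAddOrder P :=
    (lDerivEK_ne_zero_iff_not_isOfFinAddOrder W N K hGZ hK hHN ⟨Dt, H, ι, hP⟩).mp hLK
  have hKU : padicValNat p (W.baseChange K).shaOrder + 2 * w ≤
      2 * padicValNat p (AddSubgroup.zmultiples P).index := hU hfinK hPinf
  refine ⟨q, hq, ?_⟩
  have e1 : (padicValNat p (W.baseChange K).shaOrder : ℤ) + 2 * w ≤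
      2 * padicValNat p (AddSubgroup.zmultiples P).index := by exact_mod_cast hKU
  have e2 : (padicValNat p (W.baseChange K).shaOrder : ℤ) =
      padicValNat p W.shaOrder + padicValNat p Wd.shaOrder := by exact_mod_cast hsha
  have e3 : (padicValNat p Wd.tamagawaProduct : ℤ) = padicValNat p W.tamagawaProduct := by
    exact_mod_cast htam
  have e4 : (padicValNat p W.tamagawaProduct : ℤ) ≤ w := by exact_mod_cast htamw
  omega

/-- **Jetchev's residual Tamagawa defect, exactly (data level).** Same data as
`missingUpperBoundAt_of_shaIndexBound_sharp` WITHOUT the absorption hypothesis `ord_p ∏c_ℓ(E) ≤ w`: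
from `ord_p #Ш(E/K) + 2w ≤ 2·ord_p [E(K):ℤP]` (`hU`), `#Ш(E)_an` is a rational `q` with
`ord_p #Ш(E) + 2w ≤ ord_p q + 2·ord_p ∏_ℓ c_ℓ(E)`. With `w = 0` this is multr1-p2's
`padicValNat_shaOrder_le_add_of_shaIndexBound` (Kolyvagin's defect `2·ord_p ∏c_ℓ`); with
`w = max_q ord_p c_q(E)` (Jetchev's shape) the defect is `2·(ord_p ∏c_ℓ − max_q ord_p c_q)`, zero
exactly on mono-carrier pairs. NO typed input. [cite: Jetchev2008, Thm. 1.1 (shape)]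
[cite: JetchevSkinnerWan2017, §7.4.2 (p. 31)] [cite: Miller2011LMS, Def. 1.1] -/
theorem padicValNat_shaOrder_le_add_sub_of_shaIndexBound_sharp
    (W : WeierstrassCurve ℚ) [W.IsElliptic] [W.IsGloballyMinimal] (p : ℕ) [Fact p.Prime]
    (N : ℕ) [NeZero N] (K : Type) [Field K] [NumberField K]
    (Dt : ModularParametrizationData W N) (H : HeegnerDatum N (NumberField.discr K)) (ι : K →+* ℂ)
    (P : (W.baseChange K).toAffine.Point)
    -- the published inputs (named facts of the tree)
    (hGZ : gross_zagier N W K) (hKo : kolyvagin N W K)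
    (hGZK : rank_eq_analyticRank_of_analyticRank_le_one) (hmod : hasEntireLFunction_rat)
    -- the data
    (hK : IsImaginaryQuadratic K) (hHN : SatisfiesHeegnerHypothesis N K)
    (hP : WeierstrassCurve.Affine.Point.map ι.toRatAlgHom P = heegnerPointComplex Dt H)
    (hp2 : p ≠ 2) (hc : ¬ (p : ℤ) ∣ Dt.c) (hμ : ¬ p ∣ Units.torsionOrder K)
    (hr : W.analyticRank = 1)
    (hLt : (W.quadraticTwist (NumberField.discr K : ℚ)).entireLFunction 1 ≠ 0)
    -- a globally minimal model of the quadratic twist by `d_K`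
    (Wd : WeierstrassCurve ℚ) [Wd.IsElliptic] [Wd.IsGloballyMinimal] (Cd : VariableChange ℚ)
    (hWd : Cd • W.quadraticTwist (NumberField.discr K : ℚ) = Wd)
    (hu : padicValRat p (Cd.u : ℚ) = 0)
    (htam : padicValNat p Wd.tamagawaProduct = padicValNat p W.tamagawaProduct)
    -- the `≥`-half of the rank-zero `p`-part for the twist
    (htw : ∃ q : ℚ, Wd.entireLFunction 1 / (Wd.realPeriodRat : ℂ) = (q : ℂ) ∧
      padicValRat p q ≤ (padicValNat p Wd.shaOrder : ℤ) + padicValNat p Wd.tamagawaProduct -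
        2 * padicValNat p Wd.torsionOrder)
    -- a SHARPENED upper bound of Kolyvagin's shape over `K`
    {w : ℕ} (hU : Finite (W.baseChange K).sha → ¬ IsOfFinAddOrder P →
      padicValNat p (Nat.card (W.baseChange K).sha) + 2 * w ≤
        2 * padicValNat p (AddSubgroup.zmultiples P).index) :
    ∃ q : ℚ, shaAn W = (q : ℂ) ∧
      (padicValNat p W.shaOrder : ℤ) + 2 * w ≤
        padicValRat p q + 2 * padicValNat p W.tamagawaProduct := by
  obtain ⟨qd, hqd, hvqd⟩ := htw
  obtain ⟨-, hfinK, hsha, q, hq, hval⟩ := exists_shaAn_padicVal_eq_of_heegner W p N K Dt H ι P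
    hGZ hKo hGZK hmod hK hHN hP hp2 hc hμ hr hLt Wd Cd hWd hu qd hqd
  have hL0 : W.entireLFunction 1 = 0 := entireLFunction_one_eq_zero_of_analyticRank_eq_one hr
  obtain ⟨-, hderiv⟩ := leadingLCoeff_eq_deriv_of_analyticRank_eq_one hr
  have hLK : LDerivEK W K ≠ 0 := by
    rw [lDerivEK_eq_deriv_mul W K hmod hL0]; exact mul_ne_zero hderiv hLt
  have hPinf : ¬ IsOfFinAddOrder P :=
    (lDerivEK_ne_zero_iff_not_isOfFinAddOrder W N K hGZ hK hHN ⟨Dt, H, ι, hP⟩).mp hLK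
  have hKU : padicValNat p (W.baseChange K).shaOrder + 2 * w ≤
      2 * padicValNat p (AddSubgroup.zmultiples P).index := hU hfinK hPinf
  refine ⟨q, hq, ?_⟩
  have e1 : (padicValNat p (W.baseChange K).shaOrder : ℤ) + 2 * w ≤
      2 * padicValNat p (AddSubgroup.zmultiples P).index := by exact_mod_cast hKU
  have e2 : (padicValNat p (W.baseChange K).shaOrder : ℤ) =
      padicValNat p W.shaOrder + padicValNat p Wd.shaOrder := by exact_mod_cast hsha
  have e3 : (padicValNat p Wd.tamagawaProduct : ℤ) = padicValNat p W.tamagawaProduct := by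
    exact_mod_cast htam
  omega

/-- **Both sharpened statements at fixed Heegner data of a pair of X11b with a (ram) prime and
`d_K` ODD — every odd prime `p`** (the data-level step of §3; multr1-p2's
`halves_of_heegnerData_of_odd` (2) / `padicValNat_shaOrder_le_add_of_heegnerData_of_odd` with the
sharpened hypothesis). Transports (a)–(e) to the minimal twist model (`TwistTransport*.lean`; (d) at
odd `p` with `d_K` odd: eisenstein-p2's `X2.padicValNat_tamagawaProduct_twist_of_heegner_of_odd`),
Skinner 2016 Thm. C for the twist (`hSk`, `p ≥ 3`, multiplicative at `p`, irreducible, (ram)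
inherited), then §2's two arithmetic lemmas. From `hU : ord_p #Ш(E/K) + 2w ≤ 2·ord_p [E(K):ℤP]`:
(1) `#Ш(E)_an = q ∈ ℚ` with `ord_p #Ш(E) + 2w ≤ ord_p q + 2·ord_p ∏_ℓ c_ℓ(E)` (residual defect);
(2) if `ord_p ∏_ℓ c_ℓ(E) ≤ w`, `Typed.MissingUpperBoundAt W p`.
[cite: JetchevSkinnerWan2017, §7.4.2 (p. 31) and (eq:tamK)] [cite: Skinner2016PacificMC, Thm. C (§1) and footnote 1]
[cite: Miller2011LMS, Def. 1.1] -/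
theorem sharp_of_heegnerData_of_odd
    (W : WeierstrassCurve ℚ) [W.IsElliptic] [W.IsGloballyMinimal] (p : ℕ) [Fact p.Prime]
    [NeZero (W.conductorNorm ℤ)] (K : Type) [Field K] [NumberField K]
    (Dt : ModularParametrizationData W (W.conductorNorm ℤ))
    (H : HeegnerDatum (W.conductorNorm ℤ) (NumberField.discr K)) (ι : K →+* ℂ)
    (P : (W.baseChange K).toAffine.Point)
    -- the published inputs (named facts of the tree)
    (hGZ : gross_zagier (W.conductorNorm ℤ) W K) (hKo : kolyvagin (W.conductorNorm ℤ) W K)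
    (hSk : Skinner2016.thmC_padicValRat_bsd_rank_zero)
    (hGZK : rank_eq_analyticRank_of_analyticRank_le_one) (hmod : hasEntireLFunction_rat)
    -- the pair
    (hr : W.analyticRank = 1) (hp2 : p ≠ 2) (hmult : Mult W p) (hirr : Irr W p) (hram : Ram W p)
    -- the Heegner data (`d_K` odd, `p ∤ d_K`)
    (hK : IsImaginaryQuadratic K) (hodd : Odd (NumberField.discr K))
    (hpd : ¬ (p : ℤ) ∣ NumberField.discr K)
    (hHN : SatisfiesHeegnerHypothesis (W.conductorNorm ℤ) K)
    (hP : WeierstrassCurve.Affine.Point.map ι.toRatAlgHom P = heegnerPointComplex Dt H)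
    (hc : ¬ (p : ℤ) ∣ Dt.c) (hμ : ¬ p ∣ Units.torsionOrder K)
    (hLt : (W.quadraticTwist (NumberField.discr K : ℚ)).entireLFunction 1 ≠ 0)
    (Wd : WeierstrassCurve ℚ) [Wd.IsElliptic] [Wd.IsGloballyMinimal] (Cd : VariableChange ℚ)
    (hWd : Cd • W.quadraticTwist (NumberField.discr K : ℚ) = Wd)
    -- the sharpened bound over `K`
    {w : ℕ} (hU : Finite (W.baseChange K).sha → ¬ IsOfFinAddOrder P →
      padicValNat p (Nat.card (W.baseChange K).sha) + 2 * w ≤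
        2 * padicValNat p (AddSubgroup.zmultiples P).index) :
    (∃ q : ℚ, shaAn W = (q : ℂ) ∧
      (padicValNat p W.shaOrder : ℤ) + 2 * w ≤
        padicValRat p q + 2 * padicValNat p W.tamagawaProduct) ∧
    (padicValNat p W.tamagawaProduct ≤ w → Typed.MissingUpperBoundAt W p) := by
  have hp : p.Prime := Fact.out
  have hp3 : 3 ≤ p := by have := hp.two_le; omega
  have hD0 : (NumberField.discr K : ℚ) ≠ 0 := by exact_mod_cast NumberField.discr_ne_zero K
  haveI hEt : (W.quadraticTwist (NumberField.discr K : ℚ)).IsElliptic :=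
    W.isElliptic_quadraticTwist hD0
  -- transports (a)–(e) to the minimal twist model; (d) at odd `p` with `d_K` odd (eisenstein-p2)
  have hmultd : Wd.HasMultiplicativeReductionAtPrime p :=
    hasMultiplicativeReductionAtPrime_twist_of_heegner' W p K hK hHN hmult Cd hWd
  have hirrd : Wd.HasIrreducibleModPGaloisRep p :=
    hasIrreducibleModPGaloisRep_twist_model W p K hK.1 hirr Cd hWd
  have hramd : Ram Wd p := ram_twist_of_heegner W p K hK hHN hram Cd hWd
  have htam : padicValNat p Wd.tamagawaProduct = padicValNat p W.tamagawaProduct :=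
    X2.padicValNat_tamagawaProduct_twist_of_heegner_of_odd W p hp2 K hK hodd hpd hHN Cd hWd
  have hu : padicValRat p (Cd.u : ℚ) = 0 :=
    padicValRat_u_eq_zero_of_twist_minimal W p K hK hHN hmult Cd hWd
  -- the twist: `L(E^D,1) ≠ 0`, finiteness, and Skinner's Thm. C (`p ≥ 3`)
  have hLt' : (W.quadraticTwist (NumberField.discr K : ℚ)).entireLFunction = Wd.entireLFunction := by
    rw [← hWd, entireLFunction_smul]
  have hLd1 : Wd.entireLFunction 1 ≠ 0 := by rw [← hLt']; exact hLt
  have hrd : Wd.analyticRank = 0 := (Wd.analyticRank_eq_zero_iff_holds (hmod Wd)).2 hLd1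
  have hfinSd : Finite Wd.sha := (hGZK Wd (by omega)).2
  obtain ⟨qd, hqd, hvqd⟩ := hSk Wd p hp3 (Or.inr hmultd) hirrd hramd hLd1 hfinSd
  exact ⟨padicValNat_shaOrder_le_add_sub_of_shaIndexBound_sharp W p (W.conductorNorm ℤ) K Dt H ι P
      hGZ hKo hGZK hmod hK hHN hP hp2 hc hμ hr hLt Wd Cd hWd hu htam ⟨qd, hqd, hvqd.le⟩ hU,
    fun htamw ↦ missingUpperBoundAt_of_shaIndexBound_sharp W p (W.conductorNorm ℤ) K Dt H ι P hGZ
      hKo hGZK hmod hK hHN hP hp2 hc hμ hr hLt Wd Cd hWd hu htam htamw ⟨qd, hqd, hvqd.le⟩ hU⟩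

end Summit.BirchSwinnertonDyer.Rank1Residual.X11b

end
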